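import Mathlib
import HarnessLib
import Literature.Probability.MarkovChains.ForwardOperatorNormDuality
import Summits.Ventures.LatticeQCDFlow.Scaling.ProtocolTwoTime

/-!
# ProtocolDecorrelation — observables decorrelate geometrically along a switching protocol despite
# the drifting reference law: `Var_{π_0}(Q_0⋯Q_{m−1} g) ≤ (R·ρ²)^m Var_{π_m}(g)`; and the bridge
# `ChiSqContracts K π ρ ⇔ FwdNormSqLE π K (ρ²)` (Liu's `L²₀(π)` operator norm) for stationary layers

HONEST FRAMING: exact (Metropolis-corrected) sampling algorithms for lattice gauge theory;
figures of merit are autocorrelation/cost numbers at stated couplings and volumes; no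
continuum-physics claim.

Venture `LatticeQCDFlow` (cell pub-lqcd), topic `Scaling`; FANOUT row 19 (`su2-snf`, GEN-5).
OUR WORK (elementary), nothing cited as a fact.  Second tool file for the general-layer
work-variance law (`Scaling/GeneralLayerWorkVariance.lean`):

* `propagate_const`, `propagate_sub_const`, **`abs_propagate_sub_le`** — stochastic layers
  propagate constants, act affinely, and never increase the oscillation of an observable;
* THE FUNCTION SIDE IS THE LITERATURE'S: `FwdNormSqLE π K c` (`‖Kh‖²_π ≤ c‖h‖²_π` on `h ⊥_π 1`,
  Liu 2001 §6.7/§12.6 as typed in `Literature/…/SystematicScanThreeSchemes`,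
  `…/ForwardOperatorNormDuality`); `lawVariance_mulVec_le_of_fwdNormSqLE` (its variance form
  `Var_π(Kf) ≤ c·Var_π f` for unit row sums); and THE BRIDGE to `Scaling/ChiSqContraction`:
  **`fwdNormSqLE_of_chiSqContracts`** / **`chiSqContracts_of_fwdNormSqLE`** — for every
  `π`-STATIONARY layer, `ChiSqContracts K π ρ ⇔ FwdNormSqLE π K (ρ²)` (the density of `μK` is
  `1 + K̂(dμ/dπ − 1)`, `K̂` the time reversal, plus Liu's PROVED norm duality `‖F‖ = ‖B‖`,
  `Liu2001_lemma_12_6_3_norm{,'}`): the law-side `χ²`-contraction of the general-layer lag law IS the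
  `L²₀(π)` forward-operator norm, reversible or not; `fwdNormSqLE_of_reversible` (`c = λ⋆²`,
  the Literature's `fwdNormSqLE_pow_of_reversible` at `t = 1`); `isStationary_gibbsLaw_of_exp`
  (the tree's Boltzmann-weight stationarity convention gives Gibbs-law stationarity);
* `lawVariance_le_mul_of_le` — change of reference law for variances (`π ≤ R·π'` pointwise ⇒
  `Var_π ≤ R·Var_{π'}`), and **`lawVariance_propagate_le`** — along a protocol whose consecutive
  reference laws satisfy `π_i ≤ R·π_{i+1}` and whose layers (unit row sums) have forward-operator
  bound `ρ²` towards `π_{i+1}`: `Var_{π_0}(Q_0⋯Q_{m−1} g) ≤ (R·ρ²)^m · Var_{π_m}(g)` — with the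
  uniform linear protocol's
  `R = e^{ΔD/n}` this is `θ^{2m}`, `θ = ρ·e^{ΔD/(2n)}`, the same rate as the `χ²` side;
* scalar helpers: `evolveLaw_add`,
  `transfer_bound_mono`, and the distance sums `sum_pow_natDist_le` /
  **`sum_sum_pow_natDist_le`** — `Σ_{j,k<n} q^{|j−k|} ≤ n(1+q)/(1−q)` (`|j−k|` as truncated
  `(j−k)+(k−j)`), the combinatorial form of `2τ_int = (1+q)/(1−q)`.

NOT CLAIMED: anything quantitative about lattice kernels.
-/

namespace Summit.Ventures.LatticeQCDFlow.Scaling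

open Finset
open scoped Matrix
open Literature.Probability.MarkovChains (IsRowStochastic IsStationary stepLaw DetailedBalance
  IsIrreducible lambdaStar lawVariance lawMean lambdaStar_nonneg absSpectralGap
  LevinPeres2017_eq_12_8 stepLaw_nonneg FwdNormSqLE piInner timeReversal timeReversal_apply
  Liu2001_lemma_12_6_3_norm Liu2001_lemma_12_6_3_norm' fwdNormSqLE_pow_of_reversible
  piInner_centred_eq_lawVariance sum_mul_sub_lawMean)
open Literature.Probability.ImportanceSampling (chiSqDiv chiSqDiv_def chiSqDiv_eq_sum_sq_div)
open Summit.Ventures.LatticeQCDFlow.Exactness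
open Summit.Ventures.LatticeQCDFlow.Theory2

variable {X : Type*} [Fintype X]
/-! ## Propagated observables: oscillation, constants, decorrelation across drifting references -/

/-- Unit row sums propagate constants: `propagate Q m (fun _ => c) = fun _ => c`. -/
theorem propagate_const : ∀ (m : ℕ) (Q : ℕ → X → X → ℝ), (∀ k x, ∑ y, Q k x y = 1) →
    ∀ (c : ℝ) (x : X), propagate Q m (fun _ => c) x = c
  | 0, Q, _, c, x => rfl
  | m + 1, Q, hQ, c, x => by
      rw [propagate_succ]
      simp_rw [propagate_const m (fun i => Q (i + 1)) (fun k x => hQ (k + 1) x) c, ← sum_mul, hQ 0 x,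
        one_mul]

/-- Propagation is affine: `propagate Q m (g − c) = propagate Q m g − c` (unit row sums). -/
theorem propagate_sub_const : ∀ (m : ℕ) (Q : ℕ → X → X → ℝ), (∀ k x, ∑ y, Q k x y = 1) →
    ∀ (g : X → ℝ) (c : ℝ) (x : X), propagate Q m (fun y => g y - c) x = propagate Q m g x - c
  | 0, Q, _, g, c, x => rfl
  | m + 1, Q, hQ, g, c, x => by
      rw [propagate_succ, propagate_succ]
      simp_rw [propagate_sub_const m (fun i => Q (i + 1)) (fun k x => hQ (k + 1) x) g c, mul_sub,
        sum_sub_distrib, ← sum_mul, hQ 0 x, one_mul]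

/-- Stochastic layers do not increase the oscillation: `|g x − g y| ≤ B ⇒
|propagate Q m g x − propagate Q m g y| ≤ B`. -/
theorem abs_propagate_sub_le : ∀ (m : ℕ) (Q : ℕ → X → X → ℝ), (∀ k, IsRowStochastic (Q k)) →
    ∀ {g : X → ℝ} {B : ℝ}, (∀ x y, |g x - g y| ≤ B) → ∀ x y,
    |propagate Q m g x - propagate Q m g y| ≤ B
  | 0, Q, _, g, B, hg, x, y => hg x y
  | m + 1, Q, hQ, g, B, hg, x, y => by
      have ih := abs_propagate_sub_le m (fun i => Q (i + 1)) (fun k => hQ (k + 1)) hg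
      set h := propagate (fun i => Q (i + 1)) m g with hh
      rw [propagate_succ, propagate_succ]
      -- Σ_z Q x z h z − Σ_w Q y w h w = Σ_z Σ_w Q x z Q y w (h z − h w)
      have e : ∑ z, Q 0 x z * h z - ∑ w, Q 0 y w * h w
          = ∑ z, ∑ w, Q 0 x z * Q 0 y w * (h z - h w) := by
        have e1 : ∑ z, Q 0 x z * h z = ∑ z, ∑ w, Q 0 x z * Q 0 y w * h z := by
          refine sum_congr rfl fun z _ => ?_
          rw [← sum_mul, ← mul_sum, (hQ 0).2 y]; ring
        have e2 : ∑ w, Q 0 y w * h w = ∑ z, ∑ w, Q 0 x z * Q 0 y w * h w := by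
          rw [sum_comm]
          refine sum_congr rfl fun w _ => ?_
          rw [← sum_mul, ← sum_mul, (hQ 0).2 x]; ring
        rw [e1, e2, ← sum_sub_distrib]
        refine sum_congr rfl fun z _ => ?_
        rw [← sum_sub_distrib]
        exact sum_congr rfl fun w _ => by ring
      rw [e]
      calc |∑ z, ∑ w, Q 0 x z * Q 0 y w * (h z - h w)|
          ≤ ∑ z, |∑ w, Q 0 x z * Q 0 y w * (h z - h w)| := abs_sum_le_sum_abs _ _
        _ ≤ ∑ z, ∑ w, Q 0 x z * Q 0 y w * B := sum_le_sum fun z _ =>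
            (abs_sum_le_sum_abs _ _).trans (sum_le_sum fun w _ => by
              rw [abs_mul, abs_of_nonneg (mul_nonneg ((hQ 0).1 x z) ((hQ 0).1 y w))]
              exact mul_le_mul_of_nonneg_left (ih z w) (mul_nonneg ((hQ 0).1 x z) ((hQ 0).1 y w)))
        _ = B := by
            simp_rw [← sum_mul, ← mul_sum, (hQ 0).2 y, mul_one, (hQ 0).2 x, one_mul]

/-! ## The function-side contraction: the Literature's `L²₀(π)` operator-norm bound
`FwdNormSqLE π K c` (Liu 2001 §12.6, `‖F₀‖² ≤ c`) and its bridge to `ChiSqContracts` -/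

/-- **Variance form of the forward-operator bound**: `FwdNormSqLE π K c` (`‖Kh‖²_π ≤ c‖h‖²_π` on
`π`-mean-zero `h`, `Literature/…/SystematicScanThreeSchemes`) and unit row sums give
`Var_π(Kf) ≤ c·Var_π(f)` for EVERY `f` (centre `f`; `K` acts affinely on constants; the variance is
the least second moment). -/
theorem lawVariance_mulVec_le_of_fwdNormSqLE {K : X → X → ℝ} {π : X → ℝ} {c : ℝ}
    (hπ1 : ∑ x, π x = 1) (hK1 : ∀ x, ∑ y, K x y = 1) (hF : FwdNormSqLE π K c) (f : X → ℝ) :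
    lawVariance π (fun x => ∑ y, K x y * f y) ≤ c * lawVariance π f := by
  set m := lawMean π f with hm
  have hcen : ∑ x, π x * (f x - m) = 0 := sum_mul_sub_lawMean hπ1 f
  have hK := hF (fun x => f x - m) hcen
  have hKaff : ∀ x, (K *ᵥ fun y => f y - m) x = (∑ y, K x y * f y) - m := by
    intro x
    simp only [Matrix.mulVec, dotProduct, mul_sub, sum_sub_distrib, ← sum_mul, hK1 x, one_mul]
  have h1 : lawVariance π (fun x => ∑ y, K x y * f y) ≤ ∑ x, π x * ((∑ y, K x y * f y) - m) ^ 2 := by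
    unfold lawVariance lawMean
    exact sum_mul_sq_sub_mean_le hπ1 _ m
  have h2 : ∑ x, π x * ((∑ y, K x y * f y) - m) ^ 2
      = piInner π (K *ᵥ fun y => f y - m) (K *ᵥ fun y => f y - m) := by
    unfold piInner
    exact sum_congr rfl fun x _ => by rw [hKaff x, sq]
  have h3 : piInner π (fun x => f x - m) (fun x => f x - m) = lawVariance π f := by
    rw [hm]; exact piInner_centred_eq_lawVariance π f
  rw [h2] at h1
  rw [← h3]
  exact h1.trans hK

/-- Density bookkeeping: if `μ = π·(1 + h)` pointwise (`π > 0`, `π`-stationary `K`), then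
`μK = π·(1 + K̂h)` with `K̂ = timeReversal π K` (`K̂(y,x) = π(x)K(x,y)/π(y)`). -/
theorem stepLaw_eq_of_density {K : X → X → ℝ} {π μ h : X → ℝ} (hπ : ∀ x, 0 < π x)
    (hst : IsStationary π K) (hμ : ∀ x, μ x = π x + π x * h x) (y : X) :
    stepLaw K μ y = π y + π y * (timeReversal π K *ᵥ h) y := by
  unfold stepLaw
  have e1 : ∑ x, μ x * K x y = ∑ x, π x * K x y + ∑ x, π x * h x * K x y := by
    rw [← sum_add_distrib]; exact sum_congr rfl fun x _ => by rw [hμ x]; ring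
  rw [e1, hst y]
  congr 1
  simp only [Matrix.mulVec, dotProduct, timeReversal_apply]
  rw [mul_sum]
  refine sum_congr rfl fun x _ => ?_
  have hπy : π y ≠ 0 := (hπ y).ne'
  field_simp

/-- … and then `χ²(μK ‖ π) = ‖K̂h‖²_π`, `χ²(μ ‖ π) = ‖h‖²_π`. -/
theorem chiSqDiv_eq_piInner_of_density {π μ h : X → ℝ} (hπ : ∀ x, 0 < π x)
    (hμ : ∀ x, μ x = π x + π x * h x) : chiSqDiv μ π = piInner π h h := by
  rw [chiSqDiv_def]
  unfold piInner
  refine sum_congr rfl fun x _ => ?_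
  have hπx : π x ≠ 0 := (hπ x).ne'
  rw [hμ x]
  field_simp
  ring

/-- `χ²` of the pushed-forward law in terms of the density (inner-product form). -/
theorem chiSqDiv_stepLaw_eq_piInner_of_density {K : X → X → ℝ} {π μ h : X → ℝ}
    (hπ : ∀ x, 0 < π x) (hst : IsStationary π K) (hμ : ∀ x, μ x = π x + π x * h x) :
    chiSqDiv (stepLaw K μ) π
      = piInner π (timeReversal π K *ᵥ h) (timeReversal π K *ᵥ h) :=
  chiSqDiv_eq_piInner_of_density hπ (fun y => stepLaw_eq_of_density hπ hst hμ y)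

/-- **`ChiSqContracts K π ρ ⇒ FwdNormSqLE π K̂ (ρ²)`** (`π > 0` of unit mass, `π`-stationary `K`):
test the `χ²`-contraction on the signed unit-mass law `μ = π(1 + h)`, `h ⊥_π 1`. -/
theorem fwdNormSqLE_timeReversal_of_chiSqContracts {K : X → X → ℝ} {π : X → ℝ} {ρ : ℝ}
    (hπ : ∀ x, 0 < π x) (hπ1 : ∑ x, π x = 1) (hst : IsStationary π K)
    (hC : ChiSqContracts K π ρ) : FwdNormSqLE π (timeReversal π K) (ρ ^ 2) := by
  intro h hh
  have hμ1 : ∑ x, (π x + π x * h x) = 1 := by rw [sum_add_distrib, hπ1, hh, add_zero]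
  have hmain := hC (fun x => π x + π x * h x) hμ1
  rwa [chiSqDiv_stepLaw_eq_piInner_of_density hπ hst (fun x => rfl),
    chiSqDiv_eq_piInner_of_density hπ (fun x => rfl)] at hmain

/-- **`ChiSqContracts K π ρ ⇒ FwdNormSqLE π K (ρ²)`**: by Liu's norm duality `‖F‖ = ‖B‖`
(`Literature/…/ForwardOperatorNormDuality`, Lemma 12.6.3, PROVED there) the bound passes from the
reversal back to the layer.  So A's law-side `χ²`-contraction IS the Literature's `L²₀(π)`
forward-operator bound, for every `π`-stationary layer. -/
theorem fwdNormSqLE_of_chiSqContracts {K : X → X → ℝ} {π : X → ℝ} {ρ : ℝ}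
    (hπ : ∀ x, 0 < π x) (hπ1 : ∑ x, π x = 1) (hst : IsStationary π K)
    (hC : ChiSqContracts K π ρ) : FwdNormSqLE π K (ρ ^ 2) :=
  Liu2001_lemma_12_6_3_norm' hπ hst (sq_nonneg ρ)
    (fwdNormSqLE_timeReversal_of_chiSqContracts hπ hπ1 hst hC)

/-- **Converse: `FwdNormSqLE π K c ⇒ ChiSqContracts K π √c`** (`π > 0` of unit mass,
`π`-stationary `K` with unit row sums, `c ≥ 0`): duality to the reversal, then the density of `μK`
with respect to `π` is `1 + K̂(dμ/dπ − 1)` for EVERY unit-mass `μ`.  Hence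
`ChiSqContracts K π ρ ⇔ FwdNormSqLE π K (ρ²)` for stationary layers. -/
theorem chiSqContracts_of_fwdNormSqLE {K : X → X → ℝ} {π : X → ℝ} {c : ℝ}
    (hπ : ∀ x, 0 < π x) (hπ1 : ∑ x, π x = 1) (hK1 : ∀ x, ∑ y, K x y = 1)
    (hst : IsStationary π K) (hc : 0 ≤ c) (hF : FwdNormSqLE π K c) :
    ChiSqContracts K π (Real.sqrt c) := by
  have hB := Liu2001_lemma_12_6_3_norm hπ hK1 hc hF
  intro μ hμ1
  set h : X → ℝ := fun x => μ x / π x - 1 with hh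
  have hμx : ∀ x, μ x = π x + π x * h x := by
    intro x; have hπx : π x ≠ 0 := (hπ x).ne'; rw [hh]; field_simp; ring
  have hmean : ∑ x, π x * h x = 0 := by
    have e : ∀ x, π x * h x = μ x - π x := by intro x; rw [hμx x]; ring
    simp_rw [e, sum_sub_distrib, hμ1, hπ1, sub_self]
  rw [chiSqDiv_stepLaw_eq_piInner_of_density hπ hst hμx, chiSqDiv_eq_piInner_of_density hπ hμx,
    Real.sq_sqrt hc]
  exact hB h hmean

/-- Stationarity of the Boltzmann WEIGHT `e^{−S}` (the tree's convention for admissible NE-MCMC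
layers) is stationarity of the Gibbs LAW `e^{−S}/Z`. -/
theorem isStationary_gibbsLaw_of_exp [Nonempty X] {S : X → ℝ} {P : X → X → ℝ}
    (h : IsStationary (fun x => Real.exp (-(S x))) P) : IsStationary (gibbsLaw S) P := by
  intro y
  have hy := h y
  unfold gibbsLaw
  simp only [div_mul_eq_mul_div, ← sum_div]
  rw [hy]

/-- **Reversible irreducible layers**: `FwdNormSqLE π K (λ⋆²)` — the Literature's
`fwdNormSqLE_pow_of_reversible` at `t = 1` (Levin–Peres (12.8) read as an operator norm). -/
theorem fwdNormSqLE_of_reversible [DecidableEq X] {K : X → X → ℝ} {π : X → ℝ}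
    (hπ : ∀ x, 0 < π x) (hπ1 : ∑ x, π x = 1) (hK : IsRowStochastic K) (hDB : DetailedBalance π K)
    (hirr : IsIrreducible K) : FwdNormSqLE π K (lambdaStar K ^ 2) := by
  have h := fwdNormSqLE_pow_of_reversible hπ hπ1 hK hDB hirr 1
  rw [pow_one, mul_one] at h
  have e : 1 - absSpectralGap K = lambdaStar K := by unfold absSpectralGap; ring
  rwa [e] at h

/-- Change of reference law for variances: `π ≤ R·π'` pointwise ⇒ `Var_π(h) ≤ R·Var_{π'}(h)`
(`π ≥ 0`, unit mass). -/
theorem lawVariance_le_mul_of_le {π π' : X → ℝ} (hπ1 : ∑ x, π x = 1)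
    {R : ℝ} (hR : ∀ x, π x ≤ R * π' x) (h : X → ℝ) :
    lawVariance π h ≤ R * lawVariance π' h := by
  have h1 : lawVariance π h ≤ ∑ x, π x * (h x - lawMean π' h) ^ 2 := by
    unfold lawVariance lawMean
    exact sum_mul_sq_sub_mean_le hπ1 h _
  refine h1.trans ?_
  unfold lawVariance
  rw [mul_sum]
  refine sum_le_sum fun x _ => ?_
  rw [← mul_assoc]
  exact mul_le_mul_of_nonneg_right (hR x) (sq_nonneg _)

/-- **Observables decorrelate geometrically along the protocol despite the drifting reference.**
If every `Q i` has unit row sums and forward-operator bound `FwdNormSqLE (π (i+1)) (Q i) (ρ²)`, and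
consecutive reference laws satisfy `π i ≤ R·π (i+1)` pointwise (unit mass), then
`Var_{π 0}(Q_0 ⋯ Q_{m−1} g) ≤ (R·ρ²)^m · Var_{π m}(g)`. -/
theorem lawVariance_propagate_le : ∀ (m : ℕ) (Q : ℕ → X → X → ℝ) (π : ℕ → X → ℝ) {ρ R : ℝ},
    (∀ i, FwdNormSqLE (π (i + 1)) (Q i) (ρ ^ 2)) → (∀ i x, ∑ y, Q i x y = 1) →
    (∀ i, ∑ x, π i x = 1) → 0 ≤ R → (∀ i x, π i x ≤ R * π (i + 1) x) → ∀ g : X → ℝ,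
    lawVariance (π 0) (propagate Q m g) ≤ (R * ρ ^ 2) ^ m * lawVariance (π m) g
  | 0, Q, π, ρ, R, _, _, _, _, _, g => by simp
  | m + 1, Q, π, ρ, R, hV, hQ1, hπ1, hR0, hR, g => by
      have ih := lawVariance_propagate_le m (fun i => Q (i + 1)) (fun i => π (i + 1))
        (fun i => hV (i + 1)) (fun i => hQ1 (i + 1)) (fun i => hπ1 (i + 1)) hR0
        (fun i => hR (i + 1)) g
      have hstep : lawVariance (π 0) (propagate Q (m + 1) g)
          ≤ R * (ρ ^ 2 * lawVariance (π 1) (propagate (fun i => Q (i + 1)) m g)) := by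
        have h1 := lawVariance_le_mul_of_le (hπ1 0) (hR 0) (propagate Q (m + 1) g)
        refine h1.trans (mul_le_mul_of_nonneg_left ?_ hR0)
        exact lawVariance_mulVec_le_of_fwdNormSqLE (hπ1 1) (hQ1 0) (hV 0)
          (propagate (fun i => Q (i + 1)) m g)
      calc lawVariance (π 0) (propagate Q (m + 1) g)
          ≤ R * (ρ ^ 2 * lawVariance (π 1) (propagate (fun i => Q (i + 1)) m g)) := hstep
        _ ≤ R * (ρ ^ 2 * ((R * ρ ^ 2) ^ m * lawVariance (π (m + 1)) g)) :=
            mul_le_mul_of_nonneg_left (mul_le_mul_of_nonneg_left ih (sq_nonneg _)) hR0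
        _ = (R * ρ ^ 2) ^ (m + 1) * lawVariance (π (m + 1)) g := by ring

/-! ## Scalar helpers for the work-variance law -/

/-- Time-additivity of the marginals: `μ_{j+m}[P] = (μ_j)[P_{j+·}]_m`. -/
theorem evolveLaw_add (P : ℕ → X → X → ℝ) (μ : X → ℝ) (j : ℕ) :
    ∀ m, evolveLaw P μ (j + m) = evolveLaw (fun i => P (j + i)) (evolveLaw P μ j) m
  | 0 => rfl
  | m + 1 => by
      rw [← Nat.add_assoc, evolveLaw_succ, evolveLaw_add P μ j m]
      rfl

/-- Monotonicity of the transfer bound `V + a·B·√V` in `V` and `a`. -/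
theorem transfer_bound_mono {V V' a a' B : ℝ} (hVV' : V ≤ V') (ha0 : 0 ≤ a)
    (haa' : a ≤ a') (hB : 0 ≤ B) : V + a * (B * Real.sqrt V) ≤ V' + a' * (B * Real.sqrt V') :=
  add_le_add hVV' (mul_le_mul haa' (mul_le_mul_of_nonneg_left (Real.sqrt_le_sqrt hVV') hB)
    (mul_nonneg hB (Real.sqrt_nonneg _)) (ha0.trans haa'))

/-- Inner geometric sum over the distance `|j − k| = (j − k) + (k − j)` (truncated subtraction):
`Σ_{k<n} q^{|j−k|} ≤ (1 + q)/(1 − q)` for `0 ≤ q < 1`, `j < n`. -/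
theorem sum_pow_natDist_le {q : ℝ} (hq0 : 0 ≤ q) (hq1 : q < 1) {n j : ℕ} (hj : j < n) :
    ∑ k ∈ range n, q ^ ((j - k) + (k - j)) ≤ (1 + q) / (1 - q) := by
  have h1q : 0 < 1 - q := sub_pos.mpr hq1
  have hgeom : ∀ N, ∑ i ∈ range N, q ^ i ≤ 1 / (1 - q) := by
    intro N
    rw [geom_sum_eq hq1.ne N, show (q ^ N - 1) / (q - 1) = (1 - q ^ N) / (1 - q) by
      rw [div_eq_div_iff (sub_neg.mpr hq1).ne h1q.ne']; ring]
    exact div_le_div_of_nonneg_right (by linarith [pow_nonneg hq0 N]) h1q.le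
  rw [range_eq_Ico, ← sum_Ico_consecutive _ (Nat.zero_le (j + 1)) (by omega : j + 1 ≤ n)]
  have part1 : ∑ k ∈ Ico 0 (j + 1), q ^ ((j - k) + (k - j)) ≤ 1 / (1 - q) := by
    rw [← range_eq_Ico]
    have e : ∑ k ∈ range (j + 1), q ^ ((j - k) + (k - j)) = ∑ i ∈ range (j + 1), q ^ i := by
      rw [← sum_range_reflect (fun i => q ^ i) (j + 1)]
      refine sum_congr rfl fun k hk => ?_
      have hk' : k ≤ j := Nat.lt_succ_iff.mp (mem_range.mp hk)
      rw [Nat.sub_eq_zero_of_le hk', add_zero, show j + 1 - 1 - k = j - k by omega]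
    rw [e]
    exact hgeom _
  have part2 : ∑ k ∈ Ico (j + 1) n, q ^ ((j - k) + (k - j)) ≤ q / (1 - q) := by
    rw [sum_Ico_eq_sum_range]
    have e : ∑ i ∈ range (n - (j + 1)), q ^ ((j - (j + 1 + i)) + (j + 1 + i - j))
        = q * ∑ i ∈ range (n - (j + 1)), q ^ i := by
      rw [mul_sum]
      refine sum_congr rfl fun i _ => ?_
      rw [show j - (j + 1 + i) = 0 by omega, show j + 1 + i - j = i + 1 by omega, zero_add,
        pow_succ, mul_comm]
    rw [e, show q / (1 - q) = q * (1 / (1 - q)) by ring]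
    exact mul_le_mul_of_nonneg_left (hgeom _) hq0
  rw [show (1 + q) / (1 - q) = 1 / (1 - q) + q / (1 - q) by ring]
  exact add_le_add part1 part2

/-- The double sum: `Σ_{j<n} Σ_{k<n} q^{|j−k|} ≤ n·(1+q)/(1−q)`. -/
theorem sum_sum_pow_natDist_le {q : ℝ} (hq0 : 0 ≤ q) (hq1 : q < 1) (n : ℕ) :
    ∑ j ∈ range n, ∑ k ∈ range n, q ^ ((j - k) + (k - j)) ≤ n * ((1 + q) / (1 - q)) := by
  calc ∑ j ∈ range n, ∑ k ∈ range n, q ^ ((j - k) + (k - j))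
      ≤ ∑ j ∈ range n, (1 + q) / (1 - q) :=
        sum_le_sum fun j hj => sum_pow_natDist_le hq0 hq1 (mem_range.mp hj)
    _ = n * ((1 + q) / (1 - q)) := by rw [sum_const, card_range, nsmul_eq_mul]


end Summit.Ventures.LatticeQCDFlow.Scaling
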